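import Mathlib
import Summits.Ventures.HodgeRepro2.T5AdicCompletionHenselian
import Summits.Ventures.HodgeRepro2.T5AdicCompletionNormGroup
import Summits.Ventures.HodgeRepro2.T5LocalNormCharacter

/-!
# The norm group of a quadratic extension of completions is OPEN: `U_{Kv}^{(2e+1)} ⊆ N Lwˣ`

`Kv ⊆ Lw` Mathlib's completions at a finite place `w ∣ v`, `σ ∈ Gal(Lw/Kv)`, and
`normGroup v w σ = {u ∈ Kvˣ | ∃ x ∈ Lw, x · σ x = alg u}` (`T5AdicCompletionNormGroup`). NO
hypothesis on the place (inert, ramified, wild, split) and none on `σ` in this file.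

* `exists_sq_add_self_eq_of_mem_maximalIdeal`: HENSEL for `Y² + Y − t` (`t ∈ 𝔪`; the derivative at
  `0` is the unit `1`, so the simple-root Hensel lemma of `T5AdicCompletionHenselian` applies at
  EVERY residue characteristic);
* `exists_sq_eq_of_sub_one_mem_four_mul`: a unit `u = 1 + 4t`, `t ∈ 𝔪`, is the square `(1 + 2a)²`
  with `a ∈ 𝔪` (`a² + a = t`) — «`U^{(2e+1)} ⊆ (Kvˣ)²`», `e = v_K(2)`;
* `sq_mem_normGroup`: squares are norms (`x² = N(alg x)`);
* **`mem_normGroup_of_val_sub_one_lt_val_four`**: every `u ∈ Kvˣ` with `v (u − 1) < v 4` is a norm —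
  the CONDUCTOR EXPONENT of `η_v` is `≤ 2 v_K(2) + 1` (`= 1` when `2` is a unit);
* `setOf_val_sub_one_le_mem_nhds_one`, `normGroup_mem_nhds_one`, **`isOpen_normGroup`**: the norm
  group is an OPEN subgroup of `Kvˣ`;
* **`continuous_normChar_of_index_two`**: `η_v = normChar v w σ hind` is CONTINUOUS whenever
  `hind : (normGroup v w σ).index = 2` — at the wild ramified places as well (`T5LocalNormCharacter`
  had the inert and the tame ramified cases through the principal units).

Serre, *Local Fields*, Ch. XIV §4 Prop. 9 (`x ↦ x^p` maps `U^{(m)}` onto `U^{(m+e)}` for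
`m > e/(p−1)`; here `p = 2`, `m = e + 1`: the units `≡ 1 mod 4𝔪` are squares) and its Lemma 3 (`ℤ₂`). The lattice-theoretic (Herbrand) bound through
`T5InducedLatticeCohomology` gives the same openness with a weaker radius and is not needed here.

Declaration per README §8(d): «uses an L-value-free non-vanishing device: NO».
-/

namespace Summit.Ventures.HodgeRepro2.T5NormGroupOpen

open IsDedekindDomain HeightOneSpectrum IsLocalRing WithZero Polynomial T5AdicCompletionNormGroup

variable {K : Type*} [Field K] [NumberField K] (v : HeightOneSpectrum (NumberField.RingOfIntegers K))

section Squares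

/-- HENSEL FOR `Y² + Y − t`: for `t ∈ 𝔪` there is `a ∈ 𝔪` with `a² + a = t`
(`f = X² + (X − C t)` is monic, `f(0) = −t ∈ 𝔪`, `f'(0) = 1`). -/
theorem exists_sq_add_self_eq_of_mem_maximalIdeal {t : adicCompletionIntegers K v}
    (ht : t ∈ maximalIdeal (adicCompletionIntegers K v)) :
    ∃ a : adicCompletionIntegers K v, a ^ 2 + a = t ∧
      a ∈ maximalIdeal (adicCompletionIntegers K v) := by
  have hmonic : (X ^ 2 + (X - C t) : (adicCompletionIntegers K v)[X]).Monic :=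
    monic_X_pow_add (by rw [degree_X_sub_C]; exact_mod_cast one_lt_two)
  have h₁ : (X ^ 2 + (X - C t) : (adicCompletionIntegers K v)[X]).eval 0 ∈
      maximalIdeal (adicCompletionIntegers K v) := by
    simp only [eval_add, eval_pow, eval_X, eval_sub, eval_C]
    simpa using (maximalIdeal (adicCompletionIntegers K v)).neg_mem ht
  have h₂ : IsUnit ((X ^ 2 + (X - C t) : (adicCompletionIntegers K v)[X]).derivative.eval 0) := by
    simp only [derivative_add, derivative_X_pow, derivative_sub, derivative_X, derivative_C,
      sub_zero, eval_add, eval_mul, eval_C, eval_pow, eval_X]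
    norm_num
  obtain ⟨a, ha, ha0⟩ := T5AdicCompletionHenselian.exists_isRoot_of_eval_mem_maximalIdeal v
    (X ^ 2 + (X - C t)) hmonic 0 h₁ h₂
  refine ⟨a, ?_, by simpa using ha0⟩
  have h := ha
  simp only [IsRoot, eval_add, eval_pow, eval_X, eval_sub, eval_C] at h
  rw [← sub_eq_zero, ← h]
  ring

/-- A unit `u = 1 + 4 t` with `t ∈ 𝔪` is the SQUARE `(1 + 2 a)²`, `a ∈ 𝔪`. -/
theorem exists_sq_eq_of_sub_one_mem_four_mul (u : adicCompletionIntegers K v)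
    (hu : ∃ t ∈ maximalIdeal (adicCompletionIntegers K v), u = 1 + 4 * t) :
    ∃ a ∈ maximalIdeal (adicCompletionIntegers K v), (1 + 2 * a) ^ 2 = u := by
  obtain ⟨t, ht, rfl⟩ := hu
  obtain ⟨a, ha, ha0⟩ := exists_sq_add_self_eq_of_mem_maximalIdeal v ht
  refine ⟨a, ha0, ?_⟩
  rw [← ha]
  ring

end Squares

section NormGroup

variable {L : Type*} [Field L] [NumberField L] [Algebra K L]
  (w : HeightOneSpectrum (NumberField.RingOfIntegers L)) [w.asIdeal.LiesOver v.asIdeal]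
  (σ : Gal(adicCompletion L w/adicCompletion K v))

/-- Squares are norms: `x² = N (alg x)`. -/
theorem sq_mem_normGroup (x : (adicCompletion K v)ˣ) : x ^ 2 ∈ normGroup v w σ := by
  refine ⟨algebraMap (adicCompletion K v) (adicCompletion L w) (x : adicCompletion K v), ?_⟩
  rw [AlgEquiv.commutes, ← map_mul, Units.val_pow_eq_pow_val, sq]

/-- `v 4 ≤ 1`. -/
theorem val_four_le_one : Valued.v (4 : adicCompletion K v) ≤ 1 := by
  have h := (mem_adicCompletionIntegers _ _ _).mp (4 : adicCompletionIntegers K v).2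
  have e : ((4 : adicCompletionIntegers K v) : adicCompletion K v) = 4 := rfl
  rwa [e] at h

/-- THE CONDUCTOR BOUND: every `u ∈ Kvˣ` with `v (u − 1) < v 4` is a norm
(`u = (1 + 2a)²` is a square). -/
theorem mem_normGroup_of_val_sub_one_lt_val_four (u : (adicCompletion K v)ˣ)
    (hu : Valued.v ((u : adicCompletion K v) - 1) < Valued.v (4 : adicCompletion K v)) :
    u ∈ normGroup v w σ := by
  have h4 : (4 : adicCompletion K v) ≠ 0 := by
    intro h
    rw [h, map_zero] at hu
    exact absurd hu (not_lt.mpr zero_le)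
  have h4v : 0 < Valued.v (4 : adicCompletion K v) :=
    lt_of_le_of_ne zero_le (Ne.symm ((Valuation.ne_zero_iff _).mpr h4))
  set t : adicCompletion K v := ((u : adicCompletion K v) - 1) / 4 with ht
  have htv : Valued.v t < 1 := by
    rw [ht, map_div₀]
    exact (div_lt_one₀ h4v).mpr hu
  have htO : t ∈ adicCompletionIntegers K v := by
    rw [mem_adicCompletionIntegers]; exact htv.le
  have htm : (⟨t, htO⟩ : adicCompletionIntegers K v) ∈ maximalIdeal (adicCompletionIntegers K v) :=
    (T5AdicCompletionResidueField.mem_maximalIdeal_iff v _).mpr htv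
  have huO : (u : adicCompletion K v) ∈ adicCompletionIntegers K v := by
    rw [mem_adicCompletionIntegers]
    have e : (u : adicCompletion K v) = ((u : adicCompletion K v) - 1) + 1 := (sub_add_cancel _ _).symm
    rw [e]
    exact (Valuation.map_add _ _ _).trans
      (max_le (hu.le.trans (val_four_le_one v)) (by rw [map_one]))
  have hueq : (⟨(u : adicCompletion K v), huO⟩ : adicCompletionIntegers K v) = 1 + 4 * ⟨t, htO⟩ := by
    apply Subtype.ext
    show (u : adicCompletion K v) = 1 + 4 * t
    rw [ht, mul_div_cancel₀ _ h4]
    ring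
  obtain ⟨a, -, ha⟩ := exists_sq_eq_of_sub_one_mem_four_mul v _ ⟨⟨t, htO⟩, htm, hueq⟩
  refine ⟨algebraMap (adicCompletion K v) (adicCompletion L w)
    (((1 + 2 * a : adicCompletionIntegers K v) : adicCompletionIntegers K v) : adicCompletion K v), ?_⟩
  rw [AlgEquiv.commutes, ← map_mul]
  congr 1
  have h : (((1 + 2 * a) ^ 2 : adicCompletionIntegers K v) : adicCompletion K v) =
      (u : adicCompletion K v) := congrArg Subtype.val ha
  rw [← h]
  push_cast
  ring

/-- `{u ∈ Kvˣ | v (u − 1) ≤ exp k}` is a neighbourhood of `1`. -/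
theorem setOf_val_sub_one_le_mem_nhds_one (k : ℤ) :
    {u : (adicCompletion K v)ˣ | Valued.v ((u : adicCompletion K v) - 1) ≤ exp k} ∈
      nhds (1 : (adicCompletion K v)ˣ) := by
  have h0 : {x : adicCompletion K v | Valued.v x ≤ exp k} ∈ nhds (0 : adicCompletion K v) :=
    T5ValuedBallBasis.ball_mem_nhds_zero k
  have hf : Continuous fun u : (adicCompletion K v)ˣ => (u : adicCompletion K v) - 1 :=
    Units.continuous_val.sub continuous_const
  have hc := hf.continuousAt (x := (1 : (adicCompletion K v)ˣ))
  rw [ContinuousAt] at hc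
  simp only [Units.val_one, sub_self] at hc
  exact hc h0

/-- The norm group is a neighbourhood of `1` in `Kvˣ`. -/
theorem normGroup_mem_nhds_one :
    ((normGroup v w σ : Subgroup (adicCompletion K v)ˣ) : Set (adicCompletion K v)ˣ) ∈
      nhds (1 : (adicCompletion K v)ˣ) := by
  haveI : CharZero (adicCompletion K v) :=
    charZero_of_injective_algebraMap (algebraMap K (adicCompletion K v)).injective
  have h4 : Valued.v (4 : adicCompletion K v) ≠ 0 := (Valuation.ne_zero_iff _).mpr (by norm_num)
  refine Filter.mem_of_superset (setOf_val_sub_one_le_mem_nhds_one v (log (Valued.v (4 : adicCompletion K v)) - 1)) ?_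
  intro u hu
  apply mem_normGroup_of_val_sub_one_lt_val_four v w σ u
  calc Valued.v ((u : adicCompletion K v) - 1) ≤ exp (log (Valued.v (4 : adicCompletion K v)) - 1) := hu
    _ < exp (log (Valued.v (4 : adicCompletion K v))) := by rw [exp_lt_exp]; omega
    _ = Valued.v (4 : adicCompletion K v) := exp_log h4

/-- THE NORM GROUP IS OPEN in `Kvˣ` — at every finite place, without hypotheses. -/
theorem isOpen_normGroup :
    IsOpen ((normGroup v w σ : Subgroup (adicCompletion K v)ˣ) : Set (adicCompletion K v)ˣ) :=
  Subgroup.isOpen_of_mem_nhds _ (normGroup_mem_nhds_one v w σ)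

/-- `η_v = normChar v w σ hind` is CONTINUOUS whenever the norm index is `2` (`hind`: the inert case
`T5AdicCompletionNormGroup`, the tame ramified case `T5TameRamifiedNormGroup`, the ramified case of any
residue characteristic `T5QuadraticNormIndex`). -/
theorem continuous_normChar_of_index_two (hind : (normGroup v w σ).index = 2) :
    Continuous (T5LocalNormCharacter.normChar v w σ hind) :=
  T5ProfiniteCharacterExtension.continuous_of_eq_one_on_open_subgroup
    (T5LocalNormCharacter.normChar v w σ hind) (normGroup v w σ) (isOpen_normGroup v w σ)
    (fun _ hy => T5LocalNormCharacter.normChar_apply_of_mem v w σ hind hy)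

end NormGroup

end Summit.Ventures.HodgeRepro2.T5NormGroupOpen
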